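import Summits.QuantumFields.BalabanUV.T4Continuum.Support.SubstrateChartRealSliceSpecies

/-!
# SUBSTRATE — [dict] D-8: THE BOUND LETTER OF THE COVARIANCE SPECIES ON THE CHART BALL (W-15; discharges the DISPLAYED `hC` of
# p225952 `SubstrateChartRealSliceSpecies.hslice_covAtTLev_chi`): an explicit operator-norm and ENTRY bound of the two-sided unit-lattice
# covariance `unitCovT c a s Γ R S = s • (Q(R) · G(R,S) · Qᴬ(S))` at the chart points `(expChartT P R⁰ A, expChartInvT P R⁰ A)`,
# `‖A‖ < rhoLev`, every level — `‖C_k‖ ≤ ‖s k‖ · (4∕γ) · (3|o|+1)² ∕ (lev k)^d` — hence the five `hslice` clauses for a covariance entry with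
# NO displayed bound

Cell `pub-balaban`, SUBSTRATE cell, seat `b2b-balaban-substrate-p2` (gen 4).  Summits-side under the LEAN PLACEMENT RULE.  Follower of
`SubstrateChartRealSliceSpecies` (p225952, substrate-p1) composing BY NAME p3's chart moduli (`CovariantVectorChartModulus`:
`norm_expChart_sub_le`, `norm_expChartInv_sub_le`, `norm_transport_sub_transport_le`, `opNorm_Qcov_sub_Qcov_le`, `opNorm_Qcov_le_of_norm_le_one`;
`CovariantVectorChartFactorisation`: `Etr`, `QcovA_eq_conjTranspose`), p3's form-relative radius (`CovariantVectorCoerciveHoloForm.rhoStar ≤ 1∕4`,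
`≤ 1∕(3(d+1)+1)`), p1's explicit tower radius `rhoLev` + `opNorm_greenT_le_on_ballExplicit` (p223952) and `hslice_chi` (p225952).
HONEST FRAMING: rung (B)+1 of the FINITE-VOLUME T⁴ programme — NOT infinite volume, NOT a mass gap, NOT Clay; spine PROVED 0∕9; NE5 NOT PRINTED ∕
NOT proved.  FINITE-DIMENSIONAL OPERATOR-NORM BOOKKEEPING on the substrate's own species: the Green bound `4∕γ` is p3's count, the averaging moduli are
p3's; nothing of Bałaban's is asserted; the constant below is SYMBOLIC-AND-TRUE, not print's (1.5)-type number; the ℰ-families stay DISPLAYED (θ8).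
Consumer: NE5 owner g35-d `OutputRateComplexSlice.operatorRate_complex_of_realSlice(_each)` — the closed-disc BOUND clause of `hslice` for operator
families that READ the covariance species (`rawTOfRecord.gc`), through p1's `hslice_covAtTLev_chi` whose `hC` this file supplies.
HONEST DEPENDENCY (cell line, verbatim): continuum YM on T⁴ ⇐ BetaPertH ∧ nine spine estimates (0/9 proved); BetaPertH ⇐ (D1) ∧ (D4) ∧ CAP+tail;
G-an2-4 gates asym, D1 and NE2/3/4.

WHAT.
* §1 block level: `Etr_le_one` (`ℓ·δ ≤ 1∕2 ⇒ (1+δ)^ℓ − 1 ≤ 1`, Bernoulli), `opNorm_Qcov_le_of_near` ∕ `opNorm_QcovA_le_of_near` (`‖Q(R)‖, ‖Qᴬ(S)‖ ≤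
  ((2|o|+1) + |o|·Etr δ ℓ)∕√(n^d)` for data `δ`-close to references of norm `≤ 1`), `opNorm_unitCovT_le` (`‖s•QGQᴬ‖ ≤ ‖s‖·q·g·q`), `norm_unitCovT_entry_le`.
* §2 one chart level at a unitary centre: `opNorm_Qcov_expChart_le` ∕ `opNorm_QcovA_expChartInv_le` (`δ := ‖A‖·e^{‖A‖}`); the SCALING SMALLNESS
  `ell_mul_delta_le_half` (`‖A‖ ≤ ρ∕n`, `ρ ≤ ¼`, `ρ ≤ 1∕(3(d+1)+1)`, `ℓ ≤ (d+1)·n` ⇒ `ℓ·(‖A‖e^{‖A‖}) ≤ ½`) and `avgFactor_le` (`E ≤ 1 ⇒ (2|o|+1) + |o|·E ≤ 3|o|+1`).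
* §3 tower: `covBound P γ s k := ‖s k‖ · (4∕γ) · (3|o|+1)² ∕ (lev k)^d` (+ `covBound_nonneg`, `covBound_le_levelFree`); on the level-`k` CYLINDER
  `levelBall k (rhoStar∕lev k)` (p224945 — the level-uniform slot of R-ne9leaf08g15-1): `ell_mul_delta_le_half_of_mem_levelBall`, `opNorm_Qcov_le_on_levelBall` ∕
  `opNorm_QcovA_le_on_levelBall` (`≤ (3|o|+1)∕√((lev k)^d)`), **`opNorm_unitCovT_le_on_levelBall`**, `norm_covAtTLev_le_on_levelBall`; on the tower ball `ball 0 rhoLev`: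
  **`opNorm_unitCovT_le_on_ballExplicit`**, **`norm_covAtTLev_le_on_ballExplicit`** (= the `hC` of `hslice_covAtTLev_chi`, every level `k : ℕ`, entry, tag),
  **`hslice_covAtTLev_chi_explicit`** — ALL FIVE CLAUSES PROVED for a covariance entry read through `chi`, bound `covBound` — and the NAMED-DISC form
  `norm_covAtTLev_sliceDisc_le` (composable into common-`γ` packages).
-/

noncomputable section

open scoped BigOperators ComplexConjugate Matrix Matrix.Norms.L2Operator Kronecker ComplexOrder

namespace Summit.QuantumFields.BalabanUV.T4Continuum.SubstrateCovarianceChartBound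

open Literature.MathematicalPhysics.QuantumFieldTheory.Balaban1983to89
open Literature.MathematicalPhysics.QuantumFieldTheory.Balaban1983to89.B5Prop11Plancherel (Tor fine)
open Literature.MathematicalPhysics.QuantumFieldTheory.Balaban1983to89.B5G183RateUnitTower (lev lev_neZero)
open Summit.QuantumFields.BalabanUV.T4Continuum
open Summit.QuantumFields.BalabanUV.T4Continuum.BalabanAveragedTowerUnit (norm_entry_le_opNorm)
open Summit.QuantumFields.BalabanUV.T4Continuum.CovariantBlockAveraging (transport ContourSystem Qcov)
open Summit.QuantumFields.BalabanUV.T4Continuum.CoerciveInverseTower (Coercive)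
open Summit.QuantumFields.BalabanUV.T4Continuum.CovariantVectorCoercive (vecOp)
open Summit.QuantumFields.BalabanUV.T4Continuum.CovariantVectorChartModulus (norm_expChart_sub_le norm_expChartInv_sub_le norm_of_unitary
  norm_transport_sub_transport_le opNorm_Qcov_sub_Qcov_le opNorm_Qcov_le_of_norm_le_one)
open Summit.QuantumFields.BalabanUV.T4Continuum.CovariantVectorChartFactorisation (Etr Etr_nonneg QcovA_eq_conjTranspose)
open Summit.QuantumFields.BalabanUV.T4Continuum.SubstrateBackgroundTransporters (unitMod)
open Summit.QuantumFields.BalabanUV.T4Continuum.SubstrateTransporterSpecies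
open Summit.QuantumFields.BalabanUV.T4Continuum.SubstrateTransporterSpeciesHolo (expChartT expChartInvT expChartT_apply expChartInvT_apply)
open Summit.QuantumFields.BalabanUV.T4Continuum.SubstrateTransporterSpeciesLev (cPr aPr covAtTLev)
open Summit.QuantumFields.BalabanUV.T4Continuum.SubstrateTransporterSpeciesLevExplicit (rhoLev rhoLev_le_div opNorm_greenT_le_on_ballExplicit
  analyticOnNhd_covAtTLev_printed_on_ballExplicit levelBall ball_rhoLev_subset_levelBall mem_regularSetAt_of_mem_levelBall)
open Summit.QuantumFields.BalabanUV.T4Continuum.SubstrateChartSection (chi)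
open Summit.QuantumFields.BalabanUV.T4Continuum.SubstrateChartRealSlice (unitaryLev)
open Summit.QuantumFields.BalabanUV.T4Continuum.SubstrateChartRealSliceSpecies (hslice_chi)

variable {d : ℕ} {o : Type*} [Fintype o] [DecidableEq o] [Nonempty o]

/-! ## §1 Block level: norms of the averaging factors near contractions, and of the covariance -/

omit [Fintype o] [DecidableEq o] [Nonempty o] in
/-- [folklore] **THE TRANSPORT MODULUS IS AT MOST ONE** when `ℓ·δ ≤ 1∕2`: `(1+δ)^ℓ − 1 ≤ 1` (Bernoulli: `(1 − ℓδ)(1+δ)^ℓ ≤ (1−δ)^ℓ(1+δ)^ℓ ≤ 1`). -/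
theorem Etr_le_one {δ : ℝ} (hδ : 0 ≤ δ) {ℓ : ℕ} (h : (ℓ : ℝ) * δ ≤ 1 / 2) : Etr δ ℓ ≤ 1 := by
  show (1 + δ) ^ ℓ - 1 ≤ 1
  rcases Nat.eq_zero_or_pos ℓ with hℓ | hℓ
  · subst hℓ; norm_num
  have hδ1 : δ ≤ 1 / 2 := by
    have h1 : (1 : ℝ) ≤ ℓ := by exact_mod_cast hℓ
    nlinarith
  -- Bernoulli: `1 - ℓδ ≤ (1 - δ)^ℓ`
  have hB : 1 - (ℓ : ℝ) * δ ≤ (1 - δ) ^ ℓ := by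
    have := one_add_mul_le_pow (show (-2 : ℝ) ≤ -δ by linarith) ℓ
    simpa [sub_eq_add_neg, mul_neg] using this
  have hprod : (1 - δ) ^ ℓ * (1 + δ) ^ ℓ ≤ 1 := by
    rw [← mul_pow]
    have h01 : 0 ≤ (1 - δ) * (1 + δ) := mul_nonneg (by linarith) (by linarith)
    have h1 : (1 - δ) * (1 + δ) ≤ 1 := by nlinarith
    exact pow_le_one₀ h01 h1
  have hpos : 0 ≤ (1 + δ) ^ ℓ := pow_nonneg (by linarith) ℓ
  have hhalf : (1 / 2 : ℝ) * (1 + δ) ^ ℓ ≤ 1 :=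
    calc (1 / 2 : ℝ) * (1 + δ) ^ ℓ ≤ (1 - ℓ * δ) * (1 + δ) ^ ℓ := mul_le_mul_of_nonneg_right (by linarith) hpos
      _ ≤ (1 - δ) ^ ℓ * (1 + δ) ^ ℓ := mul_le_mul_of_nonneg_right hB hpos
      _ ≤ 1 := hprod
  linarith

section Block

variable (n : ℕ) [NeZero n] (M : Fin d → ℕ) [hM : ∀ μ, NeZero (M μ)]

/-- [folklore] **`‖Q(R)‖ ≤ ((2|o|+1) + |o|·E)∕√(n^d)`** for data `R` bondwise `δ`-close to a reference `R′` of norm `≤ 1`, contours of length `≤ ℓ`,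
`E = Etr δ ℓ` (p3's `opNorm_Qcov_le_of_norm_le_one` + `opNorm_Qcov_sub_Qcov_le` + `norm_transport_sub_transport_le`). -/
theorem opNorm_Qcov_le_of_near (Γ : ContourSystem d n M) {ℓ : ℕ} (hΓ : ∀ y j μ (t : Fin n), (Γ y j μ t).length ≤ ℓ)
    {R R' : Fin d → (Tor (fine n M) × Fin d → Matrix o o ℂ)} {δ : ℝ} (hδ : 0 ≤ δ) (hR' : ∀ ν i, ‖R' ν i‖ ≤ 1)
    (hRR' : ∀ ν i, ‖R ν i - R' ν i‖ ≤ δ) :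
    ‖Qcov n M Γ R‖ ≤ ((2 * Fintype.card o + 1) + Fintype.card o * Etr δ ℓ) * (Real.sqrt ((n : ℝ) ^ d))⁻¹ := by
  have hTR : ∀ y j μ (t : Fin n), ‖transport (fine n M) R μ (Γ y j μ t) - transport (fine n M) R' μ (Γ y j μ t)‖ ≤ Etr δ ℓ :=
    fun y j μ t => norm_transport_sub_transport_le (fine n M) hδ hR' hRR' μ (hΓ y j μ t)
  have h1 : ‖Qcov n M Γ R - Qcov n M Γ R'‖ ≤ Fintype.card o * Etr δ ℓ * (Real.sqrt ((n : ℝ) ^ d))⁻¹ :=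
    opNorm_Qcov_sub_Qcov_le n M Γ (Etr_nonneg hδ ℓ) hTR
  have h2 := opNorm_Qcov_le_of_norm_le_one n M Γ hR'
  calc ‖Qcov n M Γ R‖ ≤ ‖Qcov n M Γ R'‖ + ‖Qcov n M Γ R - Qcov n M Γ R'‖ := norm_le_insert' _ _
    _ ≤ (2 * Fintype.card o + 1) * (Real.sqrt ((n : ℝ) ^ d))⁻¹ + Fintype.card o * Etr δ ℓ * (Real.sqrt ((n : ℝ) ^ d))⁻¹ := add_le_add h2 h1
    _ = _ := by ring

/-- [folklore] **`‖Qᴬ(S)‖ ≤ ((2|o|+1) + |o|·E)∕√(n^d)`** likewise (`Qᴬ(S) = Q(adjOf S)ᴴ`, `‖Mᴴ‖ = ‖M‖`, `adjOf` bondwise isometric). -/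
theorem opNorm_QcovA_le_of_near (Γ : ContourSystem d n M) {ℓ : ℕ} (hΓ : ∀ y j μ (t : Fin n), (Γ y j μ t).length ≤ ℓ)
    {S S' : Fin d → (Tor (fine n M) × Fin d → Matrix o o ℂ)} {δ : ℝ} (hδ : 0 ≤ δ) (hS' : ∀ ν i, ‖S' ν i‖ ≤ 1)
    (hSS' : ∀ ν i, ‖S ν i - S' ν i‖ ≤ δ) :
    ‖QcovA n M Γ S‖ ≤ ((2 * Fintype.card o + 1) + Fintype.card o * Etr δ ℓ) * (Real.sqrt ((n : ℝ) ^ d))⁻¹ := by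
  have hS'a : ∀ ν i, ‖adjOf S' ν i‖ ≤ 1 := fun ν i => by rw [adjOf_apply, Matrix.l2_opNorm_conjTranspose]; exact hS' ν i
  have hSSa : ∀ ν i, ‖adjOf S ν i - adjOf S' ν i‖ ≤ δ := fun ν i => by
    rw [adjOf_apply, adjOf_apply, ← Matrix.conjTranspose_sub, Matrix.l2_opNorm_conjTranspose]; exact hSS' ν i
  rw [QcovA_eq_conjTranspose, Matrix.l2_opNorm_conjTranspose]
  exact opNorm_Qcov_le_of_near n M Γ hΓ hδ hS'a hSSa

omit [Nonempty o] in
/-- [folklore] **`‖s • (Q·G·Qᴬ)‖ ≤ ‖s‖·(q·g·q)`** from `‖Q‖, ‖Qᴬ‖ ≤ q`, `‖G‖ ≤ g`. -/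
theorem opNorm_unitCovT_le (c : ℂ) (a : ℝ) (s : ℂ) (Γ : ContourSystem d n M) (R S : Fin d → (Tor (fine n M) × Fin d → Matrix o o ℂ))
    {q g : ℝ} (hq : 0 ≤ q) (hQ : ‖Qcov n M Γ R‖ ≤ q) (hQA : ‖QcovA n M Γ S‖ ≤ q) (hG : ‖greenT n M c a Γ R S‖ ≤ g) :
    ‖unitCovT n M c a s Γ R S‖ ≤ ‖s‖ * (q * g * q) := by
  have hg : 0 ≤ g := (norm_nonneg _).trans hG
  unfold unitCovT
  refine (norm_smul_le _ _).trans (mul_le_mul_of_nonneg_left ?_ (norm_nonneg _))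
  calc ‖Qcov n M Γ R * greenT n M c a Γ R S * QcovA n M Γ S‖
      ≤ ‖Qcov n M Γ R * greenT n M c a Γ R S‖ * ‖QcovA n M Γ S‖ := Matrix.l2_opNorm_mul _ _
    _ ≤ (‖Qcov n M Γ R‖ * ‖greenT n M c a Γ R S‖) * ‖QcovA n M Γ S‖ :=
        mul_le_mul_of_nonneg_right (Matrix.l2_opNorm_mul _ _) (norm_nonneg _)
    _ ≤ (q * g) * q := mul_le_mul (mul_le_mul hQ hG (norm_nonneg _) hq) hQA (norm_nonneg _) (mul_nonneg hq hg)

omit [Nonempty o] in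
/-- [folklore] Every ENTRY of the covariance is bounded by its operator norm (`norm_entry_le_opNorm`). -/
theorem norm_unitCovT_entry_le (c : ℂ) (a : ℝ) (s : ℂ) (Γ : ContourSystem d n M) (R S : Fin d → (Tor (fine n M) × Fin d → Matrix o o ℂ))
    (b b' : (Tor M × Fin d) × o) : ‖unitCovT n M c a s Γ R S b b'‖ ≤ ‖unitCovT n M c a s Γ R S‖ :=
  norm_entry_le_opNorm _ b b'

/-! ## §2 One chart level at a unitary centre -/

variable {R₀ : Fin d → (Tor (fine n M) × Fin d → Matrix o o ℂ)} (hR₀ : ∀ ν i, R₀ ν i ∈ Matrix.unitaryGroup o ℂ)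

include hR₀ in
/-- [folklore] **`‖Q(e^{A}R⁰)‖ ≤ ((2|o|+1) + |o|·Etr(‖A‖e^{‖A‖}, ℓ))∕√(n^d)`** (reference `R⁰` unitary: norm `1`, distance `‖A‖e^{‖A‖}` by
`norm_expChart_sub_le`). -/
theorem opNorm_Qcov_expChart_le (Γ : ContourSystem d n M) {ℓ : ℕ} (hΓ : ∀ y j μ (t : Fin n), (Γ y j μ t).length ≤ ℓ)
    (A : Fin d → (Tor (fine n M) × Fin d → Matrix o o ℂ)) :
    ‖Qcov n M Γ (expChart R₀ A)‖
      ≤ ((2 * Fintype.card o + 1) + Fintype.card o * Etr (‖A‖ * Real.exp ‖A‖) ℓ) * (Real.sqrt ((n : ℝ) ^ d))⁻¹ :=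
  opNorm_Qcov_le_of_near n M Γ hΓ (by positivity) (fun ν i => (norm_of_unitary (hR₀ ν i)).le) (norm_expChart_sub_le hR₀ A)

include hR₀ in
/-- [folklore] **`‖Qᴬ((R⁰)⁻¹e^{−A})‖ ≤ ((2|o|+1) + |o|·Etr(‖A‖e^{‖A‖}, ℓ))∕√(n^d)`** (reference `adjOf R⁰`, `norm_expChartInv_sub_le`). -/
theorem opNorm_QcovA_expChartInv_le (Γ : ContourSystem d n M) {ℓ : ℕ} (hΓ : ∀ y j μ (t : Fin n), (Γ y j μ t).length ≤ ℓ)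
    (A : Fin d → (Tor (fine n M) × Fin d → Matrix o o ℂ)) :
    ‖QcovA n M Γ (expChartInv R₀ A)‖
      ≤ ((2 * Fintype.card o + 1) + Fintype.card o * Etr (‖A‖ * Real.exp ‖A‖) ℓ) * (Real.sqrt ((n : ℝ) ^ d))⁻¹ :=
  opNorm_QcovA_le_of_near n M Γ hΓ (by positivity)
    (fun ν i => by rw [adjOf_apply, Matrix.l2_opNorm_conjTranspose]; exact (norm_of_unitary (hR₀ ν i)).le) (norm_expChartInv_sub_le hR₀ A)

omit [Fintype o] [DecidableEq o] [Nonempty o] [NeZero n] hM in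
/-- [folklore] **THE SCALING SMALLNESS**: `‖A‖ ≤ ρ⋆∕n` with `ρ⋆ ≤ 1∕4` and `ρ⋆ ≤ 1∕(3(d+1)+1)`, contours `ℓ ≤ (d+1)·n` ⇒ `ℓ·(‖A‖e^{‖A‖}) ≤ 1∕2`
(`e^{t} ≤ 1∕(1−t) ≤ 4∕3` on `t ≤ 1∕4`, `(d+1)·ρ⋆ ≤ (d+1)∕(3(d+1)+1)`, `(4∕3)·(d+1)∕(3d+4) ≤ 1∕2`). -/
theorem ell_mul_delta_le_half {t ρ : ℝ} {ℓ : ℕ} (hn : 1 ≤ n) (ht0 : 0 ≤ t) (ht : t ≤ ρ / n) (hρ4 : ρ ≤ 1 / 4)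
    (hρd : ρ ≤ 1 / (3 * ((d : ℝ) + 1) + 1)) (hℓ : (ℓ : ℝ) ≤ ((d : ℝ) + 1) * n) :
    (ℓ : ℝ) * (t * Real.exp t) ≤ 1 / 2 := by
  have hn0 : (0 : ℝ) < n := by exact_mod_cast hn
  have hnt : (n : ℝ) * t ≤ ρ := by rwa [← le_div_iff₀' hn0]
  have hρ0 : 0 ≤ ρ := le_trans (mul_nonneg hn0.le ht0) hnt
  have ht4 : t ≤ 1 / 4 := ht.trans ((div_le_self hρ0 (by exact_mod_cast hn)).trans hρ4)
  have hexp : Real.exp t ≤ 4 / 3 := by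
    have h1 : Real.exp t ≤ 1 / (1 - t) := Real.exp_bound_div_one_sub_of_interval ht0 (by linarith)
    have h2 : 1 / (1 - t) ≤ 4 / 3 := by
      rw [div_le_div_iff₀ (by linarith) (by norm_num)]; linarith
    exact h1.trans h2
  have hd0 : (0 : ℝ) ≤ d := Nat.cast_nonneg d
  have hdρ : ((d : ℝ) + 1) * ρ ≤ ((d : ℝ) + 1) / (3 * ((d : ℝ) + 1) + 1) := by
    calc ((d : ℝ) + 1) * ρ ≤ ((d : ℝ) + 1) * (1 / (3 * ((d : ℝ) + 1) + 1)) := mul_le_mul_of_nonneg_left hρd (by linarith)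
      _ = _ := by ring
  have hd3 : ((d : ℝ) + 1) / (3 * ((d : ℝ) + 1) + 1) ≤ 3 / 8 := by
    rw [div_le_div_iff₀ (by linarith) (by norm_num)]; linarith
  have hℓ0 : (0 : ℝ) ≤ ℓ := Nat.cast_nonneg ℓ
  calc (ℓ : ℝ) * (t * Real.exp t) ≤ ((d : ℝ) + 1) * n * (t * Real.exp t) := mul_le_mul_of_nonneg_right hℓ (by positivity)
    _ = ((d : ℝ) + 1) * ((n : ℝ) * t) * Real.exp t := by ring
    _ ≤ ((d : ℝ) + 1) * ρ * (4 / 3) :=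
        mul_le_mul (mul_le_mul_of_nonneg_left hnt (by linarith)) hexp (Real.exp_pos t).le (by positivity)
    _ ≤ 3 / 8 * (4 / 3) := mul_le_mul_of_nonneg_right (hdρ.trans hd3) (by norm_num)
    _ = 1 / 2 := by norm_num

omit [DecidableEq o] [Nonempty o] in
/-- [folklore] The level-free shape of the averaging norm under the scaling smallness: `((2|o|+1) + |o|·E) ≤ 3|o|+1` once `E ≤ 1`. -/
theorem avgFactor_le {E : ℝ} (hE : E ≤ 1) :
    ((2 * (Fintype.card o : ℝ) + 1) + Fintype.card o * E) ≤ 3 * Fintype.card o + 1 := by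
  have hco : (0 : ℝ) ≤ Fintype.card o := Nat.cast_nonneg _
  nlinarith

end Block

/-! ## §3 The tower: the explicit covariance bound on `ball 0 rhoLev`, every level -/

section Tower

variable (P : Params) (Γ : (k : ℕ) → ContourSystem P.d (lev P.L k) (unitMod P))

/-- [folklore] **THE EXPLICIT COVARIANCE BOUND LETTER** `covBound P γ s k := ‖s k‖ · (4∕γ) · (3|o|+1)² ∕ (lev k)^d` (symbolic-and-true; `|o|` the colour
dimension).  HONEST: the letter is LEVEL-INDEXED — the level enters through the printed weight `‖s k‖` and the factor `(lev k)^{−d}` of the two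
averaging norms; `covBound_le_levelFree` drops the latter (`1 ≤ lev k`), and for a BOUNDED weight sequence the consumer's level-free majorant is
`(sup_k ‖s k‖)·(4∕γ)·(3|o|+1)²` — nothing more is claimed (typer (λ2)(iv)). -/
def covBound (o : Type*) [Fintype o] (γ : ℝ) (s : ℕ → ℂ) (k : ℕ) : ℝ :=
  ‖s k‖ * (4 / γ) * ((3 * Fintype.card o + 1) ^ 2 / ((lev P.L k : ℕ) : ℝ) ^ P.d)

omit [DecidableEq o] [Nonempty o] in
/-- [folklore] `0 ≤ covBound` for `0 < γ`. -/
theorem covBound_nonneg {γ : ℝ} (hγ : 0 < γ) (s : ℕ → ℂ) (k : ℕ) : 0 ≤ covBound P o γ s k := by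
  unfold covBound; positivity

omit [DecidableEq o] [Nonempty o] in
/-- [folklore] The LEVEL-FREE form of the letter: `covBound P γ s k ≤ ‖s k‖ · (4∕γ) · (3|o|+1)²` (`(lev k)^d ≥ 1`). -/
theorem covBound_le_levelFree {γ : ℝ} (hγ : 0 < γ) (s : ℕ → ℂ) (k : ℕ) :
    covBound P o γ s k ≤ ‖s k‖ * (4 / γ) * (3 * Fintype.card o + 1) ^ 2 := by
  unfold covBound
  have h1 : (1 : ℝ) ≤ ((lev P.L k : ℕ) : ℝ) ^ P.d := one_le_pow₀ (by exact_mod_cast Nat.pos_of_ne_zero (NeZero.ne _))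
  have hnum : (0 : ℝ) ≤ ‖s k‖ * (4 / γ) * (3 * Fintype.card o + 1) ^ 2 := by positivity
  calc ‖s k‖ * (4 / γ) * ((3 * (Fintype.card o : ℝ) + 1) ^ 2 / ((lev P.L k : ℕ) : ℝ) ^ P.d)
      = (‖s k‖ * (4 / γ) * (3 * Fintype.card o + 1) ^ 2) / ((lev P.L k : ℕ) : ℝ) ^ P.d := by ring
    _ ≤ ‖s k‖ * (4 / γ) * (3 * Fintype.card o + 1) ^ 2 := div_le_self hnum h1

variable {R₀ : TowerData P o} (hR₀ : ∀ (k : Fin (P.K + 1)) ν i, R₀ k ν i ∈ Matrix.unitaryGroup o ℂ) {a' γ : ℝ} (ha' : 0 ≤ a')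
  (hco : ∀ k : Fin (P.K + 1), Coercive γ (vecOp (lev P.L k) (unitMod P) a' (Γ k) (R₀ k))) (hγ : 0 < γ)
  {ℓ : Fin (P.K + 1) → ℕ} (hΓ : ∀ (k : Fin (P.K + 1)) y j μ (t : Fin (lev P.L k)), (Γ k y j μ t).length ≤ ℓ k)
  (hℓ : ∀ k : Fin (P.K + 1), (ℓ k : ℝ) ≤ ((P.d : ℝ) + 1) * (lev P.L k : ℕ))

include hℓ in
omit [Nonempty o] in
/-- [folklore] In the level-`k` CYLINDER of radius `rhoStar∕lev k` (p224945 `levelBall`; no condition at the other levels) the level-`k` slice satisfies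
the scaling smallness: `ℓ_k · (‖A k‖e^{‖A k‖}) ≤ 1∕2`. -/
theorem ell_mul_delta_le_half_of_mem_levelBall (k : Fin (P.K + 1)) {A : TowerData P o}
    (hA : A ∈ levelBall P k (CovariantVectorCoerciveHoloForm.rhoStar γ P.d a' (Fintype.card o) / (lev P.L k : ℕ))) :
    (ℓ k : ℝ) * (‖A k‖ * Real.exp ‖A k‖) ≤ 1 / 2 := by
  have hlev : 1 ≤ lev P.L k := Nat.pos_of_ne_zero (NeZero.ne _)
  refine ell_mul_delta_le_half (lev P.L k) (d := P.d) hlev (norm_nonneg _) (le_of_lt hA) ?_ ?_ (hℓ k)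
  · unfold CovariantVectorCoerciveHoloForm.rhoStar
    exact (min_le_left _ _).trans (min_le_left _ _)
  · unfold CovariantVectorCoerciveHoloForm.rhoStar
    exact (min_le_left _ _).trans (min_le_right _ _)

include hR₀ hΓ hℓ in
/-- [folklore] **`‖Q(expChartT R⁰ A k)‖ ≤ (3|o|+1)∕√((lev k)^d)`** on the level-`k` cylinder of radius `rhoStar∕lev k`. -/
theorem opNorm_Qcov_le_on_levelBall (k : Fin (P.K + 1)) {A : TowerData P o}
    (hA : A ∈ levelBall P k (CovariantVectorCoerciveHoloForm.rhoStar γ P.d a' (Fintype.card o) / (lev P.L k : ℕ))) :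
    ‖Qcov (lev P.L k) (unitMod P) (Γ k) (expChartT P R₀ A k)‖ ≤ (3 * Fintype.card o + 1) * (Real.sqrt (((lev P.L k : ℕ) : ℝ) ^ P.d))⁻¹ := by
  have hE : Etr (‖A k‖ * Real.exp ‖A k‖) (ℓ k) ≤ 1 :=
    Etr_le_one (by positivity) (ell_mul_delta_le_half_of_mem_levelBall P hℓ k hA)
  rw [expChartT_apply]
  exact (opNorm_Qcov_expChart_le (lev P.L k) (unitMod P) (hR₀ k) (Γ k) (hΓ k) (A k)).trans
    (mul_le_mul_of_nonneg_right (avgFactor_le hE) (inv_nonneg.2 (Real.sqrt_nonneg _)))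

include hR₀ hΓ hℓ in
/-- [folklore] **`‖Qᴬ(expChartInvT R⁰ A k)‖ ≤ (3|o|+1)∕√((lev k)^d)`** on the level-`k` cylinder. -/
theorem opNorm_QcovA_le_on_levelBall (k : Fin (P.K + 1)) {A : TowerData P o}
    (hA : A ∈ levelBall P k (CovariantVectorCoerciveHoloForm.rhoStar γ P.d a' (Fintype.card o) / (lev P.L k : ℕ))) :
    ‖QcovA (lev P.L k) (unitMod P) (Γ k) (expChartInvT P R₀ A k)‖ ≤ (3 * Fintype.card o + 1) * (Real.sqrt (((lev P.L k : ℕ) : ℝ) ^ P.d))⁻¹ := by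
  have hE : Etr (‖A k‖ * Real.exp ‖A k‖) (ℓ k) ≤ 1 :=
    Etr_le_one (by positivity) (ell_mul_delta_le_half_of_mem_levelBall P hℓ k hA)
  rw [expChartInvT_apply]
  exact (opNorm_QcovA_expChartInv_le (lev P.L k) (unitMod P) (hR₀ k) (Γ k) (hΓ k) (A k)).trans
    (mul_le_mul_of_nonneg_right (avgFactor_le hE) (inv_nonneg.2 (Real.sqrt_nonneg _)))

include hR₀ ha' hco hγ hΓ hℓ in
/-- [folklore] **THE COVARIANCE OPERATOR BOUND ON THE LEVEL-`k` CYLINDER** (the level-uniform slot of R-ne9leaf08g15-1: radius `rhoStar∕lev k`, no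
condition at the other levels): `‖C_k(expChartT R⁰ A k, expChartInvT R⁰ A k)‖ ≤ covBound P γ s k` at the printed letters — two averaging factors
`(3|o|+1)∕√(n^d)` around p1∕p3's Green bound `4∕γ` (p224945 `mem_regularSetAt_of_mem_levelBall`). -/
theorem opNorm_unitCovT_le_on_levelBall (s : ℕ → ℂ) (k : Fin (P.K + 1)) {A : TowerData P o}
    (hA : A ∈ levelBall P k (CovariantVectorCoerciveHoloForm.rhoStar γ P.d a' (Fintype.card o) / (lev P.L k : ℕ))) :
    ‖unitCovT (lev P.L k) (unitMod P) (cPr P k) (aPr P a' k) (s k) (Γ k) (expChartT P R₀ A k) (expChartInvT P R₀ A k)‖ ≤ covBound P o γ s k := by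
  have hn : (0 : ℝ) < (((lev P.L k : ℕ) : ℝ)) ^ P.d := pow_pos (Nat.cast_pos.2 (Nat.pos_of_ne_zero (NeZero.ne _))) _
  set q : ℝ := (3 * Fintype.card o + 1) * (Real.sqrt (((lev P.L k : ℕ) : ℝ) ^ P.d))⁻¹ with hq
  have hq0 : 0 ≤ q := by positivity
  have h := opNorm_unitCovT_le (lev P.L k) (unitMod P) (cPr P k) (aPr P a' k) (s k) (Γ k) (expChartT P R₀ A k) (expChartInvT P R₀ A k) hq0
    (opNorm_Qcov_le_on_levelBall P Γ hR₀ hΓ hℓ k hA) (opNorm_QcovA_le_on_levelBall P Γ hR₀ hΓ hℓ k hA)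
    (mem_regularSetAt_of_mem_levelBall P Γ hR₀ ha' hco hγ hΓ hℓ k hA).2
  refine h.trans (le_of_eq ?_)
  have hss : (Real.sqrt (((lev P.L k : ℕ) : ℝ) ^ P.d))⁻¹ * (Real.sqrt (((lev P.L k : ℕ) : ℝ) ^ P.d))⁻¹ = ((((lev P.L k : ℕ) : ℝ)) ^ P.d)⁻¹ := by
    rw [← mul_inv, Real.mul_self_sqrt hn.le]
  unfold covBound
  rw [hq, show (3 * (Fintype.card o : ℝ) + 1) * (Real.sqrt (((lev P.L k : ℕ) : ℝ) ^ P.d))⁻¹ * (4 / γ) *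
      ((3 * Fintype.card o + 1) * (Real.sqrt (((lev P.L k : ℕ) : ℝ) ^ P.d))⁻¹)
      = (4 / γ) * ((3 * Fintype.card o + 1) ^ 2 * ((Real.sqrt (((lev P.L k : ℕ) : ℝ) ^ P.d))⁻¹ * (Real.sqrt (((lev P.L k : ℕ) : ℝ) ^ P.d))⁻¹)) by ring,
    hss, div_eq_mul_inv]
  ring

include hR₀ ha' hco hγ hΓ hℓ in
/-- [folklore] **… AND ON THE EXPLICIT TOWER BALL `ball 0 rhoLev`, EVERY LEVEL** (`ball 0 rhoLev ⊆ levelBall k (rhoStar∕lev k)`, p224945). -/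
theorem opNorm_unitCovT_le_on_ballExplicit (s : ℕ → ℂ) {A : TowerData P o} (hA : A ∈ Metric.ball (0 : TowerData P o) (rhoLev P (o := o) γ a'))
    (k : Fin (P.K + 1)) :
    ‖unitCovT (lev P.L k) (unitMod P) (cPr P k) (aPr P a' k) (s k) (Γ k) (expChartT P R₀ A k) (expChartInvT P R₀ A k)‖ ≤ covBound P o γ s k :=
  opNorm_unitCovT_le_on_levelBall P Γ hR₀ ha' hco hγ hΓ hℓ s k (ball_rhoLev_subset_levelBall P ha' hγ k hA)

include hR₀ ha' hco hγ hΓ hℓ in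
/-- [folklore] **THE LEVEL-`k` ENTRY BOUND ON THE CYLINDER** (`k ≤ K`). -/
theorem norm_covAtTLev_le_on_levelBall (s : ℕ → ℂ) (k : Fin (P.K + 1)) {T : Type*} (t : T) (b b' : (Tor (unitMod P) × Fin P.d) × o)
    {A : TowerData P o} (hA : A ∈ levelBall P k (CovariantVectorCoerciveHoloForm.rhoStar γ P.d a' (Fintype.card o) / (lev P.L k : ℕ))) :
    ‖covAtTLev P (cPr P) (aPr P a') Γ s (expChartT P R₀ A) (expChartInvT P R₀ A) k t b b'‖ ≤ covBound P o γ s k := by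
  unfold covAtTLev covAtT
  simp only [dif_pos (Nat.le_of_lt_succ k.2), Fin.eta]
  exact (norm_unitCovT_entry_le _ _ _ _ _ _ _ _ b b').trans (opNorm_unitCovT_le_on_levelBall P Γ hR₀ ha' hco hγ hΓ hℓ s k hA)

include hR₀ ha' hco hγ hΓ hℓ in
/-- [folklore] **THE ENTRY BOUND = THE `hC` OF `hslice_covAtTLev_chi`**: every entry of `covAtTLev` at the printed letters along the tower chart is bounded
by `covBound P γ s k` on `ball 0 rhoLev`, at EVERY level `k : ℕ` (levels `k > K` read `0`), every tag `t`. -/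
theorem norm_covAtTLev_le_on_ballExplicit (s : ℕ → ℂ) (k : ℕ) {T : Type*} (t : T) (b b' : (Tor (unitMod P) × Fin P.d) × o)
    {A : TowerData P o} (hA : A ∈ Metric.ball (0 : TowerData P o) (rhoLev P (o := o) γ a')) :
    ‖covAtTLev P (cPr P) (aPr P a') Γ s (expChartT P R₀ A) (expChartInvT P R₀ A) k t b b'‖ ≤ covBound P o γ s k := by
  unfold covAtTLev covAtT
  by_cases hk : k ≤ P.K
  · simp only [dif_pos hk]
    exact (norm_unitCovT_entry_le _ _ _ _ _ _ _ _ b b').trans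
      (opNorm_unitCovT_le_on_ballExplicit P Γ hR₀ ha' hco hγ hΓ hℓ s hA ⟨k, Nat.lt_succ_of_le hk⟩)
  · simp only [dif_neg hk, norm_zero]
    exact covBound_nonneg P hγ s k

include hR₀ ha' hco hγ hΓ hℓ in
/-- [folklore] **`hslice` FOR A COVARIANCE ENTRY — ALL FIVE CLAUSES PROVED** (p1's `hslice_covAtTLev_chi` with its displayed `hC` DISCHARGED by
`norm_covAtTLev_le_on_ballExplicit`): at the printed letters, for a unitary levelwise `γ`-coercive centre, depth `0 < r`, level `k`, tag `t`, entry
`(b, b′)`, at every `u = expChartT P R⁰ A` with `(1 + r⁻¹)·‖A‖ < rhoLev`, the covariance entry read through `chi` admits the real-slice disc with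
closed-disc bound `covBound P γ s k`. -/
theorem hslice_covAtTLev_chi_explicit (s : ℕ → ℂ) {r : ℝ} (hr : 0 < r) (k : ℕ) {T : Type*} (t : T) (b b' : (Tor (unitMod P) × Fin P.d) × o)
    (A : TowerData P o) (hA : (1 + r⁻¹) * ‖A‖ < rhoLev P (o := o) γ a') :
    ∃ γc : ℂ → TowerData P o, ∃ z₀ : ℂ, ‖z₀‖ ≤ r ∧ γc z₀ = expChartT P R₀ A ∧ (∀ x : ℝ, |x| < 1 → γc x ∈ unitaryLev P o) ∧
      DiffContOnCl ℂ (fun z => covAtTLev P (cPr P) (aPr P a') Γ s (chi P (γc z)).1 (chi P (γc z)).2 k t b b') (Metric.ball (0 : ℂ) 1) ∧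
      ∀ z : ℂ, ‖z‖ ≤ 1 → ‖covAtTLev P (cPr P) (aPr P a') Γ s (chi P (γc z)).1 (chi P (γc z)).2 k t b b'‖ ≤ covBound P o γ s k :=
  hslice_chi P (fun k ν i => hR₀ k ν i) (fun RS => covAtTLev P (cPr P) (aPr P a') Γ s RS.1 RS.2 k t b b') hr
    (analyticOnNhd_covAtTLev_printed_on_ballExplicit P Γ hR₀ ha' hco hγ hΓ hℓ s k t b b')
    (fun _ hB => norm_covAtTLev_le_on_ballExplicit P Γ hR₀ ha' hco hγ hΓ hℓ s k t b b' hB) A hA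


include hR₀ ha' hco hγ hΓ hℓ in
/-- [folklore] **THE NAMED-DISC FORM** (composable with other families on the SAME disc — the common-`γ` shape of g35-d's `_each` variant, cf. the
junction remark R-ne9leaf02g15-1): along p225653's `sliceDisc R⁰ A r` (= `expChartT P R⁰ (sliceArg P A r z)`), for `(1 + r⁻¹)·‖A‖ < rhoLev` and
`‖z‖ ≤ 1`, every covariance entry is bounded by `covBound P γ s k` (companion of p225653 `diffContOnCl_covAtTLev_sliceDisc` ∕ `opNorm_greenT_sliceDisc_le`). -/
theorem norm_covAtTLev_sliceDisc_le (s : ℕ → ℂ) (k : ℕ) {T : Type*} (t : T) (b b' : (Tor (unitMod P) × Fin P.d) × o)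
    (A : TowerData P o) {r : ℝ} (hr : 0 < r) (hA : (1 + r⁻¹) * ‖A‖ < rhoLev P (o := o) γ a') {z : ℂ} (hz : ‖z‖ ≤ 1) :
    ‖covAtTLev P (cPr P) (aPr P a') Γ s (expChartT P R₀ (SubstrateChartRealSlice.sliceArg P A r z))
        (expChartInvT P R₀ (SubstrateChartRealSlice.sliceArg P A r z)) k t b b'‖ ≤ covBound P o γ s k :=
  norm_covAtTLev_le_on_ballExplicit P Γ hR₀ ha' hco hγ hΓ hℓ s k t b b' (SubstrateChartRealSlice.sliceArg_mem_ball P A hr hA hz)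

end Tower

end Summit.QuantumFields.BalabanUV.T4Continuum.SubstrateCovarianceChartBound

end
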